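import Summits.BirchSwinnertonDyer.BirchSwinnertonDyer.Theses.PrintX9
import Summits.BirchSwinnertonDyer.BirchSwinnertonDyer.Theorems.PrintX9ResplitClosersCoherentPair

/-!
# PrintX9 — ROUND 3 entry glue `HowardContainmentLightFramePinnedOfPrintSharpOfPrintMuCG` (turnkey, plan g12)

One-line closer of the definitional glue item of ROUND 3 ((CG) Greenberg LNM 1716 Prop. 2.4 by name):
from the shared μ-crux in CG form and the three print leaves (Howard 2004 Thm 1.6.1, CGLS22 Thm 4.1.1,
Greenberg Prop. 2.4 — all HYPOTHESES stated by name) to `HowardContainmentLightFramePinnedOfPrintSharp`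
via the landed closer of the g10 split.  Bookkeeping only; no summit statement is proved; BSD is not
proved by any of this.
-/

namespace Summit.BirchSwinnertonDyer.BirchSwinnertonDyer.Theorems.PrintX9PrintMuCGEntry

open Summit.BirchSwinnertonDyer.BirchSwinnertonDyer.Theses.PrintX9

/-- closes the route item `PrintX9.HowardContainmentLightFramePinnedOfPrintSharpOfPrintMuCG`. -/
theorem howardContainmentLightFramePinnedOfPrintSharpOfPrintMuCG_holds :
    HowardContainmentLightFramePinnedOfPrintSharpOfPrintMuCG :=
  fun hM hH hK hCG =>
    Summit.BirchSwinnertonDyer.BirchSwinnertonDyer.Theorems.PrintX9Resplit.howardContainmentLightFramePinnedOfPrintSharp_of_muInequalityCoherentPair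
      (hM hH hK hCG)

/-- BRIDGE: a proof of the round-2 crux `MuInequalityCoherentPairOfPrint` (23237) proves the round-3 crux. -/
theorem muInequalityCoherentPairOfPrintCG_of_ofPrint (h : MuInequalityCoherentPairOfPrint) :
    MuInequalityCoherentPairOfPrintCG :=
  fun hH hK _ => h hH hK

end Summit.BirchSwinnertonDyer.BirchSwinnertonDyer.Theorems.PrintX9PrintMuCGEntry
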